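import Summits.CriticalPhenomena.SAWScalingLimit.Theorems.SAWRenewalTightnessSubseqIdentificationTiltedBracketPieces
import Literature.Probability.RandomPlanarGeometry.SLEImageBracketEstimate
import HarnessLib

/-!
# The tilted martingale identities (line `boundary-area-law`, RS5b′/T2, Σ): the bracket cell estimate

Line `boundary-area-law` of the crux `SubseqIdentification` (stmt-CriticalPhenomena-0783), restriction
reshape (lead c4, r-c4-5), stub `stub_tiltedBracketMartingale` (Σ) = the bracket half of step (T2) of
the tilted [LSW] Theorem 6.5 (G. F. Lawler, O. Schramm, W. Werner, *Conformal restriction: the chordal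
case*, J. Amer. Math. Soc. **16** (2003), §5 (5.1)–(5.3) and Prop. 5.3). Sequel of
`…TiltedBracketCell` / `…TiltedBracketPieces`, for the product `Zⁿ · Lᵏ` of the compensated square
`Zⁿ = (Mⁿ)² − κ Cⁿ` (`Mⁿ = imgMartK κ hA hne n`, `Cⁿ = imgClockK κ hA hne n`) with `Lᵏ = locMartK κ α λ hA hne k`,
`n ≤ k`:

* `abs_setIntegral_brkCell_le` — **the cell estimate**, GIVEN constants `C_A` (second moment,
  `…TiltedBracketInterior.exists_abs_integral_mul_brkSq_le`) and `C_B` (first moment with the vanishing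
  coefficient, `…TiltedProductInterior.exists_abs_integral_mul_prod_le`) of the interior estimates: for
  `s ≤ u ≤ t₁`, `S ∈ 𝓕_s`, a threshold `κ₀` and a small step `h`,
  `|∫_S (Z_{u+h} L_{u+h} − Z_u L_u)| ≤ (C_A + 6N₀ C_B + κ·stepCK) h√h + (3D² + 4N₀D + 2κh) P(u < imgLocTimeK n < u+h)`
  `+ 2κ h cellErr + K h²` (cell decomposition `indicator_brk_sub_eq`; the weight `g E_u Mⁿ_u` is rescaled
  into `[0, 1]` as in `SLEImageBracketEstimate`; the `Y`-increment `κ h E[g E_u d² (Ŷ′ − d^α)]` is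
  `O(h · h√h)` by `abs_integral_mul_sub_leK`; the defect `abs_brkDefect_le` is integrated with the oscillation
  tail `measureReal_oscFn_incr_ge_le_pow_four` and the fourth moment of the running supremum).

References: [LSW] §5 (5.1)–(5.3), Prop. 5.3. No named fact is used.
-/

noncomputable section

open MeasureTheory Filter Topology Set Metric Function
open scoped NNReal ENNReal
open Literature.Probability.RandomPlanarGeometry
open Literature.Probability.Process (preWienerMeasure runSup runSup_nonneg integrable_runSup)

namespace Summit.CriticalPhenomena.SAWScalingLimit.Theorems.SubseqIdentification.BoundaryAreaLaw

open Loewner PathOps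

/-! ### The integral over one cell -/

section Cell

variable {κ : ℝ≥0} {α lam : ℝ} {A : Set ℂ} {hA : IsStarHull A} {hne : A.Nonempty} {n k : ℕ}
variable [MeasurableSpace C(ℝ≥0, ℝ)] [BorelSpace C(ℝ≥0, ℝ)]
variable (hκ0 : 0 < κ) (hκ : κ ≤ 8 / 3) (hαdef : α = (6 - κ) / (2 * κ)) (hlamdef : lam = (8 - 3 * κ) * (6 - κ) / (2 * κ))

-- the weights, the five integrals of the cell decomposition and the tail arithmetic in ONE proof need slightly
-- more than the default heartbeats (each piece elaborates quickly)
include hκ0 hκ hαdef hlamdef in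
set_option maxHeartbeats 400000 in
/-- **The bracket cell estimate in expectation.** Let `C_A`, `C_B` be constants of the interior estimates
(second moment `exists_abs_integral_mul_brkSq_le`, first moment `exists_abs_integral_mul_prod_le`) with horizon
`t₁`, `A ⊆ B̄(0, R)`, `n ≤ k`. For `s ≤ u ≤ t₁`, `S ∈ 𝓕_s`, a threshold `κ₀ > 0` and a small step `h ≤ 1`:
`|∫_S (Z_{u+h} L_{u+h} − Z_u L_u)| ≤ (C_A + 6N₀C_B + κ stepCK) h√h + (3D² + 4N₀D + 2κh) P(u < imgLocTimeK n < u+h)`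
`+ 2κ h cellErr n κ₀ h + K h²`, `K = K(κ, n, R, t₁, κ₀)` explicit, `D = 50h/(cₙ/16) + 4κ₀`.
[cite: LawlerSchrammWerner2003Restriction, §5 (5.1)–(5.3) and Prop. 5.3] -/
theorem abs_setIntegral_brkCell_le (hnk : n ≤ k) {R : ℝ} (hR0 : 0 < R) (hAR : A ⊆ closedBall (0 : ℂ) R)
    {t₁ : ℝ≥0} {CA CB : ℝ}
    (hCA : ∀ (u h : ℝ≥0), u ≤ t₁ → 0 < h →
      (h : ℝ) ≤ 3 * (locLevel n / 2 * (locLevel n / 16) / 4000) ^ 2 / 256 → lam * (h * massBdCell n) ≤ 1 →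
      ∀ {g : (ℝ≥0 → ℝ) → ℝ}, Measurable[brownianFiltration u] g → (∀ ω, g ω ∈ Icc (0 : ℝ) 1) →
        (∀ ω, g ω ≠ 0 → (u : WithTop ℝ≥0) < imgLocTimeK κ hA hne n ω) →
        |∫ ω, g ω * ((imageDrvFnK κ A (u + h) (brownianCPath ω) - imageDrvFnK κ A u (brownianCPath ω)) ^ 2 *
              (DFnK κ A (u + h) (brownianCPath ω) ^ α * Real.exp (-(lam * JFnK κ A u h (brownianCPath ω)))) -
            κ * starDeriv (slidHull (drvK κ (brownianCPath ω)) A u) ^ 2 *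
              starDeriv (slidHull (drvK κ (brownianCPath ω)) A u) ^ α * h) ∂preWienerMeasure| ≤ CA * h * Real.sqrt h)
    (hCB : ∀ (u h : ℝ≥0), u ≤ t₁ → 0 < h →
      (h : ℝ) ≤ 3 * (locLevel n / 2 * (locLevel n / 16) / 4000) ^ 2 / 256 → lam * (h * massBdCell n) ≤ 1 →
      ∀ {g : (ℝ≥0 → ℝ) → ℝ}, Measurable[brownianFiltration u] g → (∀ ω, g ω ∈ Icc (0 : ℝ) 1) →
        (∀ ω, g ω ≠ 0 → (u : WithTop ℝ≥0) < imgLocTimeK κ hA hne n ω) →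
        |∫ ω, g ω * ((imageDrvFnK κ A (u + h) (brownianCPath ω) - imageDrvFnK κ A u (brownianCPath ω)) *
            (DFnK κ A (u + h) (brownianCPath ω) ^ α * Real.exp (-(lam * JFnK κ A u h (brownianCPath ω)))))
            ∂preWienerMeasure| ≤ CB * h * Real.sqrt h)
    {s u h : ℝ≥0} (hsu : s ≤ u) (hut : u ≤ t₁) {S : Set (ℝ≥0 → ℝ)} (hS : MeasurableSet[brownianFiltration s] S)
    {κ₀ : ℝ} (hκ₀ : 0 < κ₀) (hh0 : 0 < h) (hh1 : (h : ℝ) ≤ 1)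
    (hhc : (h : ℝ) ≤ 3 * (locLevel n / 2 * (locLevel n / 16) / 4000) ^ 2 / 256)
    (hh2 : stepSize κ₀ h ≤ locLevel n * (locLevel n / 16) / 1000) (hh5 : lam * (h * massBdCell n) ≤ 1) :
    |∫ ω in S, ((imgMartK κ hA hne n (u + h) ω ^ 2 - κ * imgClockK κ hA hne n (u + h) ω) *
          locMartK κ α lam hA hne k (u + h) ω -
        (imgMartK κ hA hne n u ω ^ 2 - κ * imgClockK κ hA hne n u ω) * locMartK κ α lam hA hne k u ω) ∂preWienerMeasure| ≤
      (CA + 6 * (((n : ℝ) + 1) + 1160 * (3 * ((n : ℝ) + 1) + 13 * Real.sqrt ((n : ℝ) + 1) + R)) * CB +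
          κ * stepCK α lam (locLevel n / 2) (locLevel n / 16)) * h * Real.sqrt h +
        (3 * (50 * (h : ℝ) / (locLevel n / 16) + 4 * κ₀) ^ 2 +
            4 * (((n : ℝ) + 1) + 1160 * (3 * ((n : ℝ) + 1) + 13 * Real.sqrt ((n : ℝ) + 1) + R)) *
              (50 * (h : ℝ) / (locLevel n / 16) + 4 * κ₀) + 2 * κ * h) *
          preWienerMeasure.real {ω | (u : WithTop ℝ≥0) < imgLocTimeK κ hA hne n ω ∧
            imgLocTimeK κ hA hne n ω < ((u + h : ℝ≥0) : WithTop ℝ≥0)} +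
        2 * κ * h * cellErr n κ₀ h +
        (((2 * (((n : ℝ) + 1) + 1160 * (3 * ((n : ℝ) + 1) + 13 * Real.sqrt ((n : ℝ) + 1) + R)) ^ 2 + 3 * κ +
                2 * (15080 * Real.sqrt ((t₁ : ℝ) + 1) + 1160 * R) ^ 2 +
              2 * (((n : ℝ) + 1) + 1160 * (3 * ((n : ℝ) + 1) + 13 * Real.sqrt ((n : ℝ) + 1) + R)) *
                (15080 * Real.sqrt ((t₁ : ℝ) + 1) + 1160 * R)) +
              2 * (((n : ℝ) + 1) + 1160 * (3 * ((n : ℝ) + 1) + 13 * Real.sqrt ((n : ℝ) + 1) + R)) * (3482 * Real.sqrt κ) +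
              2 * (3482 * Real.sqrt κ) ^ 2) * (768 / (κ₀ / stepSigma) ^ 8) +
          (2 * (((n : ℝ) + 1) + 1160 * (3 * ((n : ℝ) + 1) + 13 * Real.sqrt ((n : ℝ) + 1) + R)) * (3482 * Real.sqrt κ) +
              2 * (3482 * Real.sqrt κ) ^ 2) * (18 * ((t₁ : ℝ) + 1) ^ 2)) * (h : ℝ) ^ 2 := by
  -- adapted from SLEImageBracketEstimate.lean (`abs_setIntegral_imgBracketCell_le`) and …TiltedProductEstimate
  haveI := isProbabilityMeasure_preWienerMeasure'
  obtain ⟨hαpos, hlam0⟩ := exponents_pos hκ hαdef hlamdef hκ0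
  obtain ⟨hc0, hc1⟩ := locLevel_pos_le n
  have hσ := stepSigma_pos
  have hκr : (0 : ℝ) ≤ κ := κ.coe_nonneg
  have hSm : MeasurableSet S := brownianFiltration.le s _ hS
  obtain ⟨hEgt_u, hEgt, hElt⟩ := measurableSet_lt_imgLocTimeK (κ := κ) (hA := hA) (hne := hne) n u (u + h)
  obtain ⟨hLm1, hLm0, hYhm, -, -, hEum⟩ := measurable_piecesK (κ := κ) (lam := lam) (hA := hA) (hne := hne) (n := k) hαpos u h
  -- constants
  set N₀ : ℝ := ((n : ℝ) + 1) + 1160 * (3 * ((n : ℝ) + 1) + 13 * Real.sqrt ((n : ℝ) + 1) + R) with hN₀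
  set Q : ℝ := 15080 * Real.sqrt ((t₁ : ℝ) + 1) + 1160 * R with hQ
  set M₁ : ℝ := 3482 * Real.sqrt κ with hM₁
  set D : ℝ := 50 * (h : ℝ) / (locLevel n / 16) + 4 * κ₀ with hD
  have hN₀1 : 1 ≤ N₀ := by
    rw [hN₀]
    have : (0 : ℝ) ≤ 1160 * (3 * ((n : ℝ) + 1) + 13 * Real.sqrt ((n : ℝ) + 1) + R) := by positivity
    linarith [n.cast_nonneg (α := ℝ)]
  have hN₀0 : 0 < N₀ := lt_of_lt_of_le one_pos hN₀1
  have hQ0 : 0 ≤ Q := by positivity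
  have hM₁0 : 0 ≤ M₁ := by positivity
  have hD0 : 0 ≤ D := by positivity
  have hN₀M : ∀ t ω, |imgMartK κ hA hne n t ω| ≤ N₀ := fun t ω ↦ abs_imgMartK_le hR0 hAR t ω
  -- the pieces along the path
  set Eu : (ℝ≥0 → ℝ) → ℝ := fun ω ↦ Real.exp (-(lam * IpnK κ hA hne k u ω)) with hEu
  set ΔΦ : (ℝ≥0 → ℝ) → ℝ := fun ω ↦ imageDrvFnK κ A (u + h) (brownianCPath ω) - imageDrvFnK κ A u (brownianCPath ω) with hΔΦ
  set Yh : (ℝ≥0 → ℝ) → ℝ := fun ω ↦ DFnK κ A (u + h) (brownianCPath ω) ^ α *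
    Real.exp (-(lam * JFnK κ A u h (brownianCPath ω))) with hYh
  set d : (ℝ≥0 → ℝ) → ℝ := fun ω ↦ starDeriv (slidHull (drvK κ (brownianCPath ω)) A u) with hd
  set Mu : (ℝ≥0 → ℝ) → ℝ := fun ω ↦ imgMartK κ hA hne n u ω with hMu
  set g0 : (ℝ≥0 → ℝ) → ℝ := fun ω ↦ S.indicator (fun _ ↦ (1 : ℝ)) ω *
    {ω | (u : WithTop ℝ≥0) < imgLocTimeK κ hA hne n ω}.indicator (fun _ ↦ (1 : ℝ)) ω with hg0
  set g : (ℝ≥0 → ℝ) → ℝ := fun ω ↦ g0 ω * Eu ω with hg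
  set g1 : (ℝ≥0 → ℝ) → ℝ := fun ω ↦ g ω * ((Mu ω + N₀) / (2 * N₀)) with hg1
  set g2 : (ℝ≥0 → ℝ) → ℝ := fun ω ↦ g ω * d ω ^ 2 with hg2
  set a : (ℝ≥0 → ℝ) → ℝ := fun ω ↦ S.indicator (fun _ ↦ (1 : ℝ)) ω * (imgMartK κ hA hne n u ω ^ 2 - κ * imgClockK κ hA hne n u ω) *
    (locMartK κ α lam hA hne k (u + h) ω - locMartK κ α lam hA hne k u ω) with ha
  set b : (ℝ≥0 → ℝ) → ℝ := fun ω ↦ g0 ω *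
    (((imgMartK κ hA hne n (u + h) ω ^ 2 - κ * imgClockK κ hA hne n (u + h) ω) -
          (imgMartK κ hA hne n u ω ^ 2 - κ * imgClockK κ hA hne n u ω)) * locMartK κ α lam hA hne k (u + h) ω -
        Eu ω * (ΔΦ ω ^ 2 * Yh ω - κ * d ω ^ 2 * d ω ^ α * h) - 2 * Eu ω * Mu ω * (ΔΦ ω * Yh ω) +
      κ * h * (Eu ω * d ω ^ 2 * (Yh ω - d ω ^ α))) with hb
  -- the weights
  have hg0mu : Measurable[brownianFiltration u] g0 :=
    ((measurable_const (a := (1 : ℝ))).indicator (brownianFiltration.mono hsu _ hS)).mul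
      ((measurable_const (a := (1 : ℝ))).indicator hEgt_u)
  have hg0_01 : ∀ ω, g0 ω = 0 ∨ g0 ω = 1 := fun ω ↦ by
    rw [hg0]; simp only
    by_cases h1 : ω ∈ S
    · by_cases h2 : ω ∈ {ω | (u : WithTop ℝ≥0) < imgLocTimeK κ hA hne n ω}
      · rw [Set.indicator_of_mem h1, Set.indicator_of_mem h2]; norm_num
      · rw [Set.indicator_of_mem h1, Set.indicator_of_notMem h2]; norm_num
    · rw [Set.indicator_of_notMem h1, zero_mul]; exact Or.inl rfl
  have hg0T : ∀ ω, g0 ω ≠ 0 → (u : WithTop ℝ≥0) < imgLocTimeK κ hA hne n ω := fun ω hω ↦ by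
    by_contra hnot
    exact hω (by rw [hg0]; simp only
                 rw [Set.indicator_of_notMem (show ω ∉ {ω | (u : WithTop ℝ≥0) < imgLocTimeK κ hA hne n ω} from hnot), mul_zero])
  have hEu01 : ∀ ω, 0 < Eu ω ∧ Eu ω ≤ 1 := fun ω ↦
    ⟨Real.exp_pos _, by rw [hEu]; simp only; rw [Real.exp_le_one_iff, neg_nonpos]; exact mul_nonneg hlam0 (IpnK_nonneg k u ω)⟩
  have hgmu : Measurable[brownianFiltration u] g := hg0mu.mul hEum
  have hgm : Measurable g := hgmu.mono (brownianFiltration.le u) le_rfl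
  have hg01 : ∀ ω, g ω ∈ Icc (0 : ℝ) 1 := fun ω ↦ by
    rw [hg]; simp only
    rcases hg0_01 ω with h | h
    · rw [h, zero_mul]; exact ⟨le_rfl, zero_le_one⟩
    · rw [h, one_mul]; exact ⟨(hEu01 ω).1.le, (hEu01 ω).2⟩
  have hgz : ∀ ω, g0 ω = 0 → g ω = 0 := fun ω h0 ↦ by rw [hg]; simp only; rw [h0, zero_mul]
  have hgT : ∀ ω, g ω ≠ 0 → (u : WithTop ℝ≥0) < imgLocTimeK κ hA hne n ω := fun ω hω ↦ hg0T ω fun h0 ↦ hω (hgz ω h0)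
  have hg1' : ∀ᵐ ω ∂preWienerMeasure, ‖g ω‖ ≤ 1 := Eventually.of_forall fun ω ↦ by
    rw [Real.norm_eq_abs, abs_of_nonneg (hg01 ω).1]; exact (hg01 ω).2
  -- `g1 = g (Mⁿ_u + N₀)/(2N₀) ∈ [0, 1]`
  have hMum : Measurable[brownianFiltration u] Mu := ((stronglyAdapted_imgMartK (κ := κ) (hA := hA) (hne := hne) n) u).measurable
  have hg1mu : Measurable[brownianFiltration u] g1 := hgmu.mul ((hMum.add_const _).div_const _)
  have hg11 : ∀ ω, g1 ω ∈ Icc (0 : ℝ) 1 := fun ω ↦ by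
    have hM := hN₀M u ω
    rw [abs_le] at hM
    have hq0 : 0 ≤ (Mu ω + N₀) / (2 * N₀) := div_nonneg (by linarith) (by positivity)
    have hq1 : (Mu ω + N₀) / (2 * N₀) ≤ 1 := by rw [div_le_one (by positivity)]; linarith
    rw [hg1]; simp only
    exact ⟨mul_nonneg (hg01 ω).1 hq0, mul_le_one₀ (hg01 ω).2 hq0 hq1⟩
  have hg1T : ∀ ω, g1 ω ≠ 0 → (u : WithTop ℝ≥0) < imgLocTimeK κ hA hne n ω := fun ω hω ↦ by
    refine hgT ω fun h0 ↦ hω ?_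
    rw [hg1]; simp only; rw [h0, zero_mul]
  -- the pieces against the weights `g`, `g1`
  obtain ⟨i1, ig0, i2, hg2mu, hg21, hg2supp, i3⟩ := brk_pieces (κ := κ) (lam := lam) (hA := hA) (hne := hne) (n := n) hαpos hlam0 hR0 hAR u h hgmu hg01 hgT
  obtain ⟨-, ig1, -, -, -, -, -⟩ := brk_pieces (κ := κ) (lam := lam) (hA := hA) (hne := hne) (n := n) hαpos hlam0 hR0 hAR u h hg1mu hg11 hg1T
  -- the cell decomposition
  have hdec : ∀ ω, S.indicator (fun ω ↦ (imgMartK κ hA hne n (u + h) ω ^ 2 - κ * imgClockK κ hA hne n (u + h) ω) *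
        locMartK κ α lam hA hne k (u + h) ω -
      (imgMartK κ hA hne n u ω ^ 2 - κ * imgClockK κ hA hne n u ω) * locMartK κ α lam hA hne k u ω) ω =
      a ω + g ω * (ΔΦ ω ^ 2 * Yh ω - κ * d ω ^ 2 * d ω ^ α * h) + 2 * (g ω * Mu ω) * (ΔΦ ω * Yh ω) -
        κ * h * (g2 ω * (Yh ω - d ω ^ α)) + b ω := fun ω ↦ by
    simp only [ha, hb, hg2, hg, hg0, hEu, hΔΦ, hYh, hd, hMu]
    exact indicator_brk_sub_eq S u h ω
  -- integrability of the past term and of the defect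
  obtain ⟨⟨NZ, hNZ0, hNZ⟩, hZm⟩ := brk_abs_le_and_stronglyMeasurable (κ := κ) (hA := hA) (hne := hne) (n := n) u
  have iL : ∀ t, Integrable (locMartK κ α lam hA hne k t) preWienerMeasure := fun t ↦ integrable_locMartK hαpos hlam0 t
  have ia : Integrable a preWienerMeasure := by
    have hFm : AEStronglyMeasurable (fun ω ↦ S.indicator (fun _ ↦ (1 : ℝ)) ω * (imgMartK κ hA hne n u ω ^ 2 - κ * imgClockK κ hA hne n u ω))
        preWienerMeasure := ((stronglyMeasurable_const.indicator hSm).mul (hZm.mono (brownianFiltration.le u))).aestronglyMeasurable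
    refine ((iL (u + h)).sub (iL u)).bdd_mul (c := NZ) hFm (Eventually.of_forall fun ω ↦ ?_)
    rw [Real.norm_eq_abs, abs_mul]
    by_cases hω : ω ∈ S
    · rw [Set.indicator_of_mem hω, abs_one, one_mul]; exact hNZ ω
    · rw [Set.indicator_of_notMem hω, abs_zero, zero_mul]; exact hNZ0
  have iZL : ∀ t, Integrable (fun ω ↦ (imgMartK κ hA hne n t ω ^ 2 - κ * imgClockK κ hA hne n t ω) * locMartK κ α lam hA hne k t ω)
      preWienerMeasure := fun t ↦ integrable_brk_mul_locMartK hαpos hlam0 t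
  have i12 : Integrable (fun ω ↦ a ω + g ω * (ΔΦ ω ^ 2 * Yh ω - κ * d ω ^ 2 * d ω ^ α * h)) preWienerMeasure := ia.add i1
  have i123' : Integrable (fun ω ↦ a ω + g ω * (ΔΦ ω ^ 2 * Yh ω - κ * d ω ^ 2 * d ω ^ α * h) + 2 * (g ω * Mu ω) * (ΔΦ ω * Yh ω))
      preWienerMeasure := i12.add i2
  have i123 : Integrable (fun ω ↦ a ω + g ω * (ΔΦ ω ^ 2 * Yh ω - κ * d ω ^ 2 * d ω ^ α * h) + 2 * (g ω * Mu ω) * (ΔΦ ω * Yh ω) -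
      κ * h * (g2 ω * (Yh ω - d ω ^ α))) preWienerMeasure := i123'.sub i3
  have ib : Integrable b preWienerMeasure := by
    have : b = fun ω ↦ S.indicator (fun ω ↦ (imgMartK κ hA hne n (u + h) ω ^ 2 - κ * imgClockK κ hA hne n (u + h) ω) *
        locMartK κ α lam hA hne k (u + h) ω - (imgMartK κ hA hne n u ω ^ 2 - κ * imgClockK κ hA hne n u ω) * locMartK κ α lam hA hne k u ω) ω -
        (a ω + g ω * (ΔΦ ω ^ 2 * Yh ω - κ * d ω ^ 2 * d ω ^ α * h) + 2 * (g ω * Mu ω) * (ΔΦ ω * Yh ω) -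
          κ * h * (g2 ω * (Yh ω - d ω ^ α))) := by
      funext ω; rw [hdec ω]; ring
    rw [this]
    exact (((iZL (u + h)).sub (iZL u)).indicator hSm).sub i123
  have hsplit : ∫ ω in S, ((imgMartK κ hA hne n (u + h) ω ^ 2 - κ * imgClockK κ hA hne n (u + h) ω) *
        locMartK κ α lam hA hne k (u + h) ω -
      (imgMartK κ hA hne n u ω ^ 2 - κ * imgClockK κ hA hne n u ω) * locMartK κ α lam hA hne k u ω) ∂preWienerMeasure =
      ∫ ω, a ω ∂preWienerMeasure + ∫ ω, g ω * (ΔΦ ω ^ 2 * Yh ω - κ * d ω ^ 2 * d ω ^ α * h) ∂preWienerMeasure +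
        ∫ ω, 2 * (g ω * Mu ω) * (ΔΦ ω * Yh ω) ∂preWienerMeasure - ∫ ω, κ * h * (g2 ω * (Yh ω - d ω ^ α)) ∂preWienerMeasure +
        ∫ ω, b ω ∂preWienerMeasure := by
    rw [← integral_indicator hSm, ← integral_add ia i1, ← integral_add i12 i2, ← integral_sub i123' i3, ← integral_add i123 ib]
    exact integral_congr_ae (Eventually.of_forall hdec)
  have hpast : ∫ ω, a ω ∂preWienerMeasure = 0 :=
    integral_brkPast_mul_sub_eq_zero (hA := hA) (hne := hne) (n := n) (k := k) hκ0 hκ hαdef hlamdef (h := h) hsu hS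
  rw [hsplit, hpast, zero_add]
  -- (A) the second moment
  have hI : |∫ ω, g ω * (ΔΦ ω ^ 2 * Yh ω - κ * d ω ^ 2 * d ω ^ α * h) ∂preWienerMeasure| ≤ CA * h * Real.sqrt h :=
    hCA u h hut hh0 hhc hh5 hgmu hg01 hgT
  -- (B) the first moment with the weight `g Mu = 2N₀ g1 − N₀ g`
  have hII : |∫ ω, 2 * (g ω * Mu ω) * (ΔΦ ω * Yh ω) ∂preWienerMeasure| ≤ 6 * N₀ * (CB * h * Real.sqrt h) := by
    have e1 := hCB u h hut hh0 hhc hh5 hg1mu hg11 hg1T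
    have e0 := hCB u h hut hh0 hhc hh5 hgmu hg01 hgT
    have heq : (fun ω ↦ 2 * (g ω * Mu ω) * (ΔΦ ω * Yh ω)) = fun ω ↦ 4 * N₀ * (g1 ω * (ΔΦ ω * Yh ω)) - 2 * N₀ * (g ω * (ΔΦ ω * Yh ω)) := by
      funext ω; rw [hg1]; simp only; field_simp; ring
    rw [heq, integral_sub (ig1.const_mul _) (ig0.const_mul _), integral_const_mul, integral_const_mul]
    calc |4 * N₀ * ∫ ω, g1 ω * (ΔΦ ω * Yh ω) ∂preWienerMeasure - 2 * N₀ * ∫ ω, g ω * (ΔΦ ω * Yh ω) ∂preWienerMeasure|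
        ≤ |4 * N₀ * ∫ ω, g1 ω * (ΔΦ ω * Yh ω) ∂preWienerMeasure| + |2 * N₀ * ∫ ω, g ω * (ΔΦ ω * Yh ω) ∂preWienerMeasure| := abs_sub _ _
      _ = 4 * N₀ * |∫ ω, g1 ω * (ΔΦ ω * Yh ω) ∂preWienerMeasure| + 2 * N₀ * |∫ ω, g ω * (ΔΦ ω * Yh ω) ∂preWienerMeasure| := by
          rw [abs_mul (4 * N₀), abs_mul (2 * N₀), abs_of_nonneg (by positivity : (0 : ℝ) ≤ 4 * N₀),
            abs_of_nonneg (by positivity : (0 : ℝ) ≤ 2 * N₀)]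
      _ ≤ 4 * N₀ * (CB * h * Real.sqrt h) + 2 * N₀ * (CB * h * Real.sqrt h) := by gcongr
      _ = _ := by ring
  -- (C) the `Y`-increment
  have hIII : |∫ ω, κ * h * (g2 ω * (Yh ω - d ω ^ α)) ∂preWienerMeasure| ≤
      κ * stepCK α lam (locLevel n / 2) (locLevel n / 16) * h * Real.sqrt h := by
    have hhc' : (h : ℝ) ≤ (locLevel n / 2 * (locLevel n / 16) / 4000) ^ 2 / 32 := by
      have : 0 ≤ (locLevel n / 2 * (locLevel n / 16) / 4000) ^ 2 := sq_nonneg _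
      linarith
    have hlamh : lam * (h * massBound (locLevel n / 2) (locLevel n / 16)) ≤ 1 := hh5
    have key := abs_integral_mul_sub_leK hκ0 hκ hαdef hlamdef hA hne (by positivity) (by linarith) (by positivity) hh0 hhc' hlamh
      hg2mu hg21 hg2supp
    rw [integral_const_mul, abs_mul, abs_of_nonneg (by positivity : (0 : ℝ) ≤ κ * h)]
    have hst0 : 0 ≤ stepCK α lam (locLevel n / 2) (locLevel n / 16) * h * Real.sqrt h := by
      have := stepCK_nonneg hαpos hlam0 (by positivity : 0 < locLevel n / 2) (by positivity : 0 < locLevel n / 16); positivity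
    calc (κ : ℝ) * h * |∫ ω, g2 ω * (Yh ω - d ω ^ α) ∂preWienerMeasure| ≤ κ * 1 * (stepCK α lam (locLevel n / 2) (locLevel n / 16) * h * Real.sqrt h) :=
          mul_le_mul (mul_le_mul_of_nonneg_left hh1 hκr) key (abs_nonneg _) (by positivity)
      _ = _ := by ring
  -- (D) the defect
  have hEm : MeasurableSet {ω | (u : WithTop ℝ≥0) < imgLocTimeK κ hA hne n ω ∧
      imgLocTimeK κ hA hne n ω < ((u + h : ℝ≥0) : WithTop ℝ≥0)} := hEgt.inter hElt
  have hBadm : MeasurableSet {ω | κ₀ / stepSigma ≤ oscFn h (incr u (brownianCPath ω))} :=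
    measurableSet_le measurable_const ((measurable_oscFn h).comp ((measurable_incr u).comp measurable_brownianCPath))
  have hk : 0 < κ₀ / stepSigma := div_pos hκ₀ hσ
  obtain ⟨iBX, iBX2, hBX, hBX2⟩ := integral_indicator_oscFn_mul_runSup_pow_le h u hk hh0
  have hPBad := measureReal_oscFn_incr_ge_le_pow_four h u hk hh0
  have hpt : ∀ ω, |b ω| ≤
      {ω | (u : WithTop ℝ≥0) < imgLocTimeK κ hA hne n ω ∧ imgLocTimeK κ hA hne n ω < ((u + h : ℝ≥0) : WithTop ℝ≥0)}.indicator
          (fun _ ↦ 3 * D ^ 2 + 4 * N₀ * D + 2 * κ * h) ω + 2 * κ * h * cellErr n κ₀ h +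
        (2 * N₀ ^ 2 + 3 * κ + 2 * Q ^ 2 + 2 * N₀ * Q) * {ω | κ₀ / stepSigma ≤ oscFn h (incr u (brownianCPath ω))}.indicator (fun _ ↦ (1 : ℝ)) ω +
        2 * N₀ * M₁ * ({ω | κ₀ / stepSigma ≤ oscFn h (incr u (brownianCPath ω))}.indicator (fun _ ↦ (1 : ℝ)) ω * runSup (u + h) ω) +
        2 * M₁ ^ 2 * ({ω | κ₀ / stepSigma ≤ oscFn h (incr u (brownianCPath ω))}.indicator (fun _ ↦ (1 : ℝ)) ω * runSup (u + h) ω ^ 2) := by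
    intro ω
    have hce0 : 0 ≤ cellErr n κ₀ h := by rw [cellErr, stepSize]; positivity
    by_cases hz : g0 ω = 0
    · rw [hb]; simp only; rw [hz, zero_mul, abs_zero]
      have hEv0 : 0 ≤ 3 * D ^ 2 + 4 * N₀ * D + 2 * κ * h := by positivity
      have := Set.indicator_nonneg (fun _ _ ↦ hEv0)
        (s := {ω | (u : WithTop ℝ≥0) < imgLocTimeK κ hA hne n ω ∧ imgLocTimeK κ hA hne n ω < ((u + h : ℝ≥0) : WithTop ℝ≥0)}) ω
      have := Set.indicator_nonneg (fun _ _ ↦ zero_le_one (α := ℝ)) (s := {ω | κ₀ / stepSigma ≤ oscFn h (incr u (brownianCPath ω))}) ω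
      have := runSup_nonneg (u + h) ω
      positivity
    · rcases hg0_01 ω with h0 | h1
      · exact absurd h0 hz
      rw [hb]; simp only; rw [h1, one_mul]
      exact abs_brkDefect_le hκ hαpos hlam0 hnk hR0 hAR hut hh0 hh1 hκ₀ hh2 (hg0T ω hz)
  have hIV := abs_integral_le_of_five_terms hEm hBadm ib iBX iBX2 hpt
  -- arithmetic on the junk terms
  have hh2' : (h : ℝ) ^ 4 ≤ h ^ 2 := pow_le_pow_of_le_one h.coe_nonneg hh1 (by norm_num)
  have hh3' : (h : ℝ) ^ 3 ≤ h ^ 2 := pow_le_pow_of_le_one h.coe_nonneg hh1 (by norm_num)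
  have huh : ((u + h : ℝ≥0) : ℝ) ^ 2 ≤ ((t₁ : ℝ) + 1) ^ 2 := by
    have huh' : ((u + h : ℝ≥0) : ℝ) ≤ (t₁ : ℝ) + 1 := by push_cast; exact add_le_add (by exact_mod_cast hut) hh1
    exact pow_le_pow_left₀ (by positivity) huh' 2
  have hk8 : 0 ≤ 768 / (κ₀ / stepSigma) ^ 8 := by positivity
  have ha1 : 0 ≤ 2 * N₀ ^ 2 + 3 * κ + 2 * Q ^ 2 + 2 * N₀ * Q := by positivity
  have ha2 : 0 ≤ 2 * N₀ * M₁ := by positivity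
  have ha3 : 0 ≤ 2 * M₁ ^ 2 := by positivity
  have j1 : (2 * N₀ ^ 2 + 3 * κ + 2 * Q ^ 2 + 2 * N₀ * Q) * preWienerMeasure.real {ω | κ₀ / stepSigma ≤ oscFn h (incr u (brownianCPath ω))} ≤
      (2 * N₀ ^ 2 + 3 * κ + 2 * Q ^ 2 + 2 * N₀ * Q) * (768 / (κ₀ / stepSigma) ^ 8) * (h : ℝ) ^ 2 := by
    have : preWienerMeasure.real {ω | κ₀ / stepSigma ≤ oscFn h (incr u (brownianCPath ω))} ≤ 768 / (κ₀ / stepSigma) ^ 8 * (h : ℝ) ^ 2 := by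
      refine hPBad.trans ?_
      rw [show 768 * (h : ℝ) ^ 4 / (κ₀ / stepSigma) ^ 8 = 768 / (κ₀ / stepSigma) ^ 8 * h ^ 4 by ring]
      exact mul_le_mul_of_nonneg_left hh2' hk8
    have := mul_le_mul_of_nonneg_left this ha1
    linarith
  have j2 : 2 * N₀ * M₁ * ∫ ω, {ω | κ₀ / stepSigma ≤ oscFn h (incr u (brownianCPath ω))}.indicator (fun _ ↦ (1 : ℝ)) ω * runSup (u + h) ω ∂preWienerMeasure ≤
      2 * N₀ * M₁ * (768 / (κ₀ / stepSigma) ^ 8 + 18 * ((t₁ : ℝ) + 1) ^ 2) * (h : ℝ) ^ 2 := by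
    have : ∫ ω, {ω | κ₀ / stepSigma ≤ oscFn h (incr u (brownianCPath ω))}.indicator (fun _ ↦ (1 : ℝ)) ω * runSup (u + h) ω ∂preWienerMeasure ≤
        (768 / (κ₀ / stepSigma) ^ 8 + 18 * ((t₁ : ℝ) + 1) ^ 2) * (h : ℝ) ^ 2 := by
      refine hBX.trans ?_
      rw [show 768 * (h : ℝ) ^ 3 / (κ₀ / stepSigma) ^ 8 = 768 / (κ₀ / stepSigma) ^ 8 * h ^ 3 by ring]
      have p1 := mul_le_mul_of_nonneg_left hh3' hk8
      have p2 : ((u + h : ℝ≥0) : ℝ) ^ 2 * (h : ℝ) ^ 3 ≤ ((t₁ : ℝ) + 1) ^ 2 * (h : ℝ) ^ 2 := mul_le_mul huh hh3' (by positivity) (by positivity)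
      linarith
    have := mul_le_mul_of_nonneg_left this ha2
    linarith
  have j3 : 2 * M₁ ^ 2 * ∫ ω, {ω | κ₀ / stepSigma ≤ oscFn h (incr u (brownianCPath ω))}.indicator (fun _ ↦ (1 : ℝ)) ω * runSup (u + h) ω ^ 2 ∂preWienerMeasure ≤
      2 * M₁ ^ 2 * (768 / (κ₀ / stepSigma) ^ 8 + 18 * ((t₁ : ℝ) + 1) ^ 2) * (h : ℝ) ^ 2 := by
    have : ∫ ω, {ω | κ₀ / stepSigma ≤ oscFn h (incr u (brownianCPath ω))}.indicator (fun _ ↦ (1 : ℝ)) ω * runSup (u + h) ω ^ 2 ∂preWienerMeasure ≤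
        (768 / (κ₀ / stepSigma) ^ 8 + 18 * ((t₁ : ℝ) + 1) ^ 2) * (h : ℝ) ^ 2 := by
      refine hBX2.trans ?_
      rw [show 768 * (h : ℝ) ^ 2 / (κ₀ / stepSigma) ^ 8 = 768 / (κ₀ / stepSigma) ^ 8 * h ^ 2 by ring]
      have p3 : ((u + h : ℝ≥0) : ℝ) ^ 2 * (h : ℝ) ^ 2 ≤ ((t₁ : ℝ) + 1) ^ 2 * (h : ℝ) ^ 2 := mul_le_mul_of_nonneg_right huh (by positivity)
      linarith
    have := mul_le_mul_of_nonneg_left this ha3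
    linarith
  calc |∫ ω, g ω * (ΔΦ ω ^ 2 * Yh ω - κ * d ω ^ 2 * d ω ^ α * h) ∂preWienerMeasure +
          ∫ ω, 2 * (g ω * Mu ω) * (ΔΦ ω * Yh ω) ∂preWienerMeasure - ∫ ω, κ * h * (g2 ω * (Yh ω - d ω ^ α)) ∂preWienerMeasure +
          ∫ ω, b ω ∂preWienerMeasure|
      ≤ |∫ ω, g ω * (ΔΦ ω ^ 2 * Yh ω - κ * d ω ^ 2 * d ω ^ α * h) ∂preWienerMeasure| +
          |∫ ω, 2 * (g ω * Mu ω) * (ΔΦ ω * Yh ω) ∂preWienerMeasure| + |∫ ω, κ * h * (g2 ω * (Yh ω - d ω ^ α)) ∂preWienerMeasure| +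
          |∫ ω, b ω ∂preWienerMeasure| :=
        (abs_add_le _ _).trans (add_le_add ((abs_sub _ _).trans (add_le_add (abs_add_le _ _) le_rfl)) le_rfl)
    _ ≤ CA * h * Real.sqrt h + 6 * N₀ * (CB * h * Real.sqrt h) + κ * stepCK α lam (locLevel n / 2) (locLevel n / 16) * h * Real.sqrt h +
          ((3 * D ^ 2 + 4 * N₀ * D + 2 * κ * h) * preWienerMeasure.real {ω | (u : WithTop ℝ≥0) < imgLocTimeK κ hA hne n ω ∧
            imgLocTimeK κ hA hne n ω < ((u + h : ℝ≥0) : WithTop ℝ≥0)} + 2 * κ * h * cellErr n κ₀ h +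
          (2 * N₀ ^ 2 + 3 * κ + 2 * Q ^ 2 + 2 * N₀ * Q) * (768 / (κ₀ / stepSigma) ^ 8) * (h : ℝ) ^ 2 +
          2 * N₀ * M₁ * (768 / (κ₀ / stepSigma) ^ 8 + 18 * ((t₁ : ℝ) + 1) ^ 2) * (h : ℝ) ^ 2 +
          2 * M₁ ^ 2 * (768 / (κ₀ / stepSigma) ^ 8 + 18 * ((t₁ : ℝ) + 1) ^ 2) * (h : ℝ) ^ 2) := by
        refine add_le_add (add_le_add (add_le_add hI hII) hIII) (hIV.trans ?_)
        linarith [j1, j2, j3]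
    _ = _ := by ring

end Cell

section Registered

/-- **Registered form** (explicit binders): `Zⁿ · Lᵏ` is integrable at every time and strongly adapted
(`α > 0`, `λ ≥ 0`; `integrable_brk_mul_locMartK`, `stronglyAdapted_brk_mul_locMartK` of `…TiltedBracketPieces`,
bundled for the registration of this file). [folklore] -/
theorem brk_mul_locMartK_integrable_and_adapted_registered :
    ∀ (κ : ℝ≥0) (α lam : ℝ) (A : Set ℂ) (hA : IsStarHull A) (hne : A.Nonempty) (n k : ℕ), 0 < α → 0 ≤ lam →
      (∀ (t : ℝ≥0), Integrable (fun ω => (imgMartK κ hA hne n t ω ^ 2 - κ * imgClockK κ hA hne n t ω) *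
        locMartK κ α lam hA hne k t ω) preWienerMeasure) ∧
      StronglyAdapted brownianFiltration (fun t ω => (imgMartK κ hA hne n t ω ^ 2 - κ * imgClockK κ hA hne n t ω) *
        locMartK κ α lam hA hne k t ω) :=
  fun _ _ _ _ _ _ _ _ hα hlam ↦ ⟨fun t ↦ integrable_brk_mul_locMartK hα hlam t, stronglyAdapted_brk_mul_locMartK hα⟩

end Registered

end Summit.CriticalPhenomena.SAWScalingLimit.Theorems.SubseqIdentification.BoundaryAreaLaw

end
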